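import Literature.Analysis.FluidPDE.MVRelativeEnergyIntegrands
import HarnessLib

/-!
# BF18 shell for functions (crux `ChaosClosesEuler`, stmt-AtomisticToContinuum-15141, line `Sketch`,
# stub `stub_bf18ShellSlice`) — the shell state in the tree's relative-energy vocabulary

WHAT. The deterministic BF18 shell of the line works with genuine fields of shell states
`U = (ϱ, m, E) : ℝ × ℝ³ × ℝ` (density, momentum, TOTAL energy; `ϱ ≥ 0`, `E ≥ 0`, `|m|² ≤ 2ϱE`) and the
monatomic equation of state `EulerEOS.monatomicExcess χe f` (`p = ρϑχe(ρ)`, `e = 3ϑ/2`, `ϑ(ρ, E_int) = 2E_int/(3ρ)`),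
whereas the tree's relative-energy machinery (`MVRelativeEnergyPointwise`, `MVRelativeEnergyIntegrands`) is written on
phase points `w = (ρ, E_int, m)` (INTERNAL energy). The shell maps `U ↦ w(U) = (U.1, U.2.2 - |U.2.1|²/(2 U.1), U.2.1)`
and writes `θo U = 2/3 (U.2.2/U.1 - |U.2.1|²/(2 U.1²))`, `pV U = U.1 · θo U · χe U.1` and the selected cut-off
`Zs U = if 0 < θo U then Z_{a,b}(3/2 log θo U - log U.1 - f U.1) else a`. This file identifies the shell's objects with
the tree's, for ALL `U` (Lean's `x/0 = 0` makes the vacuum harmless):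

* `stateTemp_shell` (= the registered `stub_bf18ShellSlice`): `ϑ(w U) = θo U`; `pressure_shell`: `p(w U) = pV U`;
  `cutoff_shell`: the selected cut-off evaluated at `s(w U)` is `Zs U`; `totalEnergy_shell`, `kinetic_add_ien_shell`:
  kinetic + internal = total energy;
* `relEnergyZ_shell`: the explicit formula `ℰ_Z = E - m·Ũ + ϱ(½|Ũ|² - μ̃) - Θ̃ ϱ Z(s) + p̃`;
* `momI_shell`, `contI_shell`, `entI_shell`, `rawRHS_shell`: the integrands of the shell's hypotheses (H1)–(H3)
  are the tree's `contI`, `momI`, `entI`, and their combination is `rawRHS`;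
* the affine bounds used for integrability and for the universal bound of the relative energy on admissible states:
  `norm_mom_shell_le` (`|m| ≤ ϱ + E`), `ien_shell_nonneg`, `ien_shell_le`, `temp_shell_nonneg`,
  `abs_pressure_shell_le`, `abs_relEnergyZ_shell_le`, `abs_rawRHS_shell_le`.

WHY. The bookkeeping through which the assembly of `stub_bf18Shell` feeds the shell's hypotheses into the tree's
pointwise master inequality and its coercivity. No named fact is invoked.
-/

noncomputable section

namespace Summit.AtomisticToContinuum.HydrodynamicLimit.Theorems.ChaosClosesEulerShellSlice

open Set Function Finset
open scoped BigOperators InnerProductSpace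
open Literature.Analysis.FluidPDE Literature.Analysis.FluidPDE.CompressibleEuler
open Literature.Analysis.FluidPDE.CompressibleEuler.StrongPointData Literature.Analysis.FluidPDE.CompressibleEuler.EulerPhase
  Literature.Analysis.FluidPDE.CompressibleEuler.EulerEOS

/-! ## Algebraic identifications (all `U`) -/

section Algebra

variable (χe f : ℝ → ℝ)

/-- (C1) The temperature of the shell state: `ϑ(ϱ, E - |m|²/(2ϱ)) = 2/3 (E/ϱ - |m|²/(2ϱ²))`, for every `U`
(both sides vanish on the vacuum by `x/0 = 0`). [folklore] -/
theorem stateTemp_shell (U : ℝ × EuclideanSpace ℝ (Fin 3) × ℝ) :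
    stateTemp (monatomicExcess χe f) U.1 (U.2.2 - ‖U.2.1‖ ^ 2 / (2 * U.1)) =
      2 / 3 * (U.2.2 / U.1 - ‖U.2.1‖ ^ 2 / (2 * U.1 ^ 2)) := by
  simp only [stateTemp, monatomicExcess]; ring

/-- (C2) The pressure of the shell state: `p(ϱ, ϑ(w U)) = ϱ · θo U · χe ϱ`. [folklore] -/
theorem pressure_shell (U : ℝ × EuclideanSpace ℝ (Fin 3) × ℝ) :
    (monatomicExcess χe f).p U.1 (stateTemp (monatomicExcess χe f) U.1 (U.2.2 - ‖U.2.1‖ ^ 2 / (2 * U.1))) =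
      U.1 * (2 / 3 * (U.2.2 / U.1 - ‖U.2.1‖ ^ 2 / (2 * U.1 ^ 2))) * χe U.1 := by
  rw [stateTemp_shell]; rfl

/-- (C3) The selected cut-off (`Z_{a,b}` on warm states, the constant `a` on cold ones) evaluated at the entropy
of the shell state is the shell's `Zs U`. [folklore] -/
theorem cutoff_shell (a b : ℝ) (U : ℝ × EuclideanSpace ℝ (Fin 3) × ℝ) :
    (if 0 < 2 / 3 * (U.2.2 / U.1 - ‖U.2.1‖ ^ 2 / (2 * U.1 ^ 2)) then clamp a b else fun _ => a)
        ((monatomicExcess χe f).s U.1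
          (stateTemp (monatomicExcess χe f) U.1 (U.2.2 - ‖U.2.1‖ ^ 2 / (2 * U.1)))) =
      if 0 < 2 / 3 * (U.2.2 / U.1 - ‖U.2.1‖ ^ 2 / (2 * U.1 ^ 2)) then
        max a (min (3 / 2 * Real.log (2 / 3 * (U.2.2 / U.1 - ‖U.2.1‖ ^ 2 / (2 * U.1 ^ 2))) -
          Real.log U.1 - f U.1) b)
      else a := by
  rw [stateTemp_shell]; split_ifs <;> rfl

/-- The selected cut-off is bounded by `max |a| |b|` (for `a ≤ b`), whatever the selector. [folklore] -/
theorem abs_cutoffSel_le {a b : ℝ} (hab : a ≤ b) (c : Prop) [Decidable c] (s : ℝ) :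
    |(if c then clamp a b else fun _ => a) s| ≤ max |a| |b| := by
  split_ifs
  · exact abs_clamp_le hab s
  · exact le_max_left _ _

/-- (C4) Kinetic plus internal energy of the shell state is the total energy, for every `U`. [folklore] -/
theorem kinetic_add_ien_shell (U : ℝ × EuclideanSpace ℝ (Fin 3) × ℝ) :
    EulerPhase.kineticEnergy (U.1, U.2.2 - ‖U.2.1‖ ^ 2 / (2 * U.1), U.2.1) +
        EulerPhase.ien (U.1, U.2.2 - ‖U.2.1‖ ^ 2 / (2 * U.1), U.2.1) = U.2.2 := by
  simp only [kineticEnergy, dens_mk, mom_mk, ien_mk]; ring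

/-- Off the vacuum the total energy is `|m|²/(2ϱ) + 3/2 ϱ θo U` (the form consumed by the `L¹` conversion).
[folklore] -/
theorem totalEnergy_shell (U : ℝ × EuclideanSpace ℝ (Fin 3) × ℝ) (h : 0 < U.1) :
    U.2.2 = ‖U.2.1‖ ^ 2 / (2 * U.1) + 3 / 2 * U.1 * (2 / 3 * (U.2.2 / U.1 - ‖U.2.1‖ ^ 2 / (2 * U.1 ^ 2))) := by
  field_simp; ring

/-- (C5) The relative energy with cut-off of the shell state, explicitly:
`ℰ_Z = E - m·Ũ + ϱ(½|Ũ|² - μ(r̃,Θ̃)) - Θ̃ ϱ Z(s(w U)) + p(r̃,Θ̃)`, for every `eos`, `Z`, `d`, `U`. [folklore] -/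
theorem relEnergyZ_shell (eos : EulerEOS) (Z : ℝ → ℝ) (d : StrongPointData)
    (U : ℝ × EuclideanSpace ℝ (Fin 3) × ℝ) :
    d.relEnergyZ eos Z (U.1, U.2.2 - ‖U.2.1‖ ^ 2 / (2 * U.1), U.2.1) =
      U.2.2 - (∑ i, U.2.1 i * d.U i) + U.1 * (‖d.U‖ ^ 2 / 2 - eos.chemPotential d.r d.Θ) -
        d.Θ * (U.1 * Z (eos.s U.1 (stateTemp eos U.1 (U.2.2 - ‖U.2.1‖ ^ 2 / (2 * U.1))))) +
        eos.p d.r d.Θ := by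
  unfold relEnergyZ; rw [kinetic_add_ien_shell]; rfl

/-- The real inner product on `ℝ³` in coordinates. [folklore] -/
theorem inner_eq_sum_mul (a b : EuclideanSpace ℝ (Fin 3)) : ⟪a, b⟫_ℝ = ∑ i, a i * b i := by
  rw [PiLp.inner_apply]; exact Finset.sum_congr rfl fun i _ => by simp [mul_comm]

/-- (C5') The relative energy of the shell state for the monatomic class with the SELECTED cut-off, in the
shell's vocabulary: `ℰ(U) = E - Ũ·m + ϱ(½|Ũ|² - μ̃) - Θ̃ ϱ Zs U + p̃`, for every `U`. [folklore] -/
theorem relEnergyZ_shell_sel (a b : ℝ) (d : StrongPointData) (U : ℝ × EuclideanSpace ℝ (Fin 3) × ℝ) :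
    d.relEnergyZ (monatomicExcess χe f)
        (if 0 < 2 / 3 * (U.2.2 / U.1 - ‖U.2.1‖ ^ 2 / (2 * U.1 ^ 2)) then clamp a b else fun _ => a)
        (U.1, U.2.2 - ‖U.2.1‖ ^ 2 / (2 * U.1), U.2.1) =
      U.2.2 - ⟪d.U, U.2.1⟫_ℝ + U.1 * (‖d.U‖ ^ 2 / 2 - (monatomicExcess χe f).chemPotential d.r d.Θ) -
        d.Θ * (U.1 * (if 0 < 2 / 3 * (U.2.2 / U.1 - ‖U.2.1‖ ^ 2 / (2 * U.1 ^ 2)) then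
          max a (min (3 / 2 * Real.log (2 / 3 * (U.2.2 / U.1 - ‖U.2.1‖ ^ 2 / (2 * U.1 ^ 2))) -
            Real.log U.1 - f U.1) b) else a)) +
        (monatomicExcess χe f).p d.r d.Θ := by
  have e : ∑ i, U.2.1 i * d.U i = ∑ i, d.U i * U.2.1 i := Finset.sum_congr rfl fun i _ => mul_comm _ _
  rw [relEnergyZ_shell, cutoff_shell, inner_eq_sum_mul, e]

/-- (C6a) The integrand of the shell's momentum hypothesis (H2) is the tree's `momI`:
`∂ₜŨ·m + ∑ᵢⱼ ∂ⱼŨᵢ (mᵢmⱼ/ϱ + δᵢⱼ pV) = m·∂ₜŨ + (m⊗m/ϱ):∇Ũ + p divŨ`, for every `U`. [folklore] -/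
theorem momI_shell (d : StrongPointData) (U : ℝ × EuclideanSpace ℝ (Fin 3) × ℝ) :
    ⟪d.Ut, U.2.1⟫_ℝ + ∑ i, ∑ j, d.gU i j * (U.2.1 i * U.2.1 j / U.1 +
        if i = j then U.1 * (2 / 3 * (U.2.2 / U.1 - ‖U.2.1‖ ^ 2 / (2 * U.1 ^ 2))) * χe U.1 else 0) =
      d.momI (monatomicExcess χe f) (U.1, U.2.2 - ‖U.2.1‖ ^ 2 / (2 * U.1), U.2.1) := by
  simp only [momI, dens_mk, mom_mk, ien_mk, pressure_shell, divU, inner_eq_sum_mul, mul_add,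
    Finset.sum_add_distrib, mul_ite, mul_zero, Finset.sum_ite_eq, Finset.mem_univ, if_true]
  simp only [Fin.sum_univ_three]
  ring

/-- (C6b) The integrand of the shell's continuity hypothesis (H1) with `φ₁` is the tree's `contI` (definitional).
[folklore] -/
theorem contI_shell (eos : EulerEOS) (d : StrongPointData) (U : ℝ × EuclideanSpace ℝ (Fin 3) × ℝ) :
    U.1 * d.φ₁t eos + ∑ j, U.2.1 j * d.gφ₁ eos j =
      d.contI eos (U.1, U.2.2 - ‖U.2.1‖ ^ 2 / (2 * U.1), U.2.1) :=
  rfl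

/-- (C6b') The same with the factors of (H1) in the order `∂ₜφ₁ · ϱ`. [folklore] -/
theorem contI_shell' (eos : EulerEOS) (d : StrongPointData) (U : ℝ × EuclideanSpace ℝ (Fin 3) × ℝ) :
    d.φ₁t eos * U.1 + ∑ j, U.2.1 j * d.gφ₁ eos j =
      d.contI eos (U.1, U.2.2 - ‖U.2.1‖ ^ 2 / (2 * U.1), U.2.1) := by
  rw [mul_comm]
  rfl

/-- (C6c) The integrand of the shell's entropy hypothesis (H3) is the tree's `entI`, for every cut-off `Z`.
[folklore] -/
theorem entI_shell (eos : EulerEOS) (Z : ℝ → ℝ) (d : StrongPointData)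
    (U : ℝ × EuclideanSpace ℝ (Fin 3) × ℝ) :
    U.1 * Z (eos.s U.1 (stateTemp eos U.1 (U.2.2 - ‖U.2.1‖ ^ 2 / (2 * U.1)))) * d.Θt +
        Z (eos.s U.1 (stateTemp eos U.1 (U.2.2 - ‖U.2.1‖ ^ 2 / (2 * U.1)))) * ⟪U.2.1, d.gΘ⟫_ℝ =
      d.entI eos Z (U.1, U.2.2 - ‖U.2.1‖ ^ 2 / (2 * U.1), U.2.1) := by
  rw [inner_eq_sum_mul, Finset.mul_sum]
  simp only [entI, dens_mk, mom_mk, ien_mk]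
  congr 1
  exact Finset.sum_congr rfl fun i _ => by ring

/-- `rawRHS = -momI + contI - entI + ∂ₜp̃` at the shell state (the tree's `rawRHS_eq_pieces`). [folklore] -/
theorem rawRHS_shell_pieces (eos : EulerEOS) (Z : ℝ → ℝ) (d : StrongPointData)
    (U : ℝ × EuclideanSpace ℝ (Fin 3) × ℝ) :
    rawRHS eos Z d U.1 (U.2.2 - ‖U.2.1‖ ^ 2 / (2 * U.1)) U.2.1 =
      -d.momI eos (U.1, U.2.2 - ‖U.2.1‖ ^ 2 / (2 * U.1), U.2.1) +
        d.contI eos (U.1, U.2.2 - ‖U.2.1‖ ^ 2 / (2 * U.1), U.2.1) -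
        d.entI eos Z (U.1, U.2.2 - ‖U.2.1‖ ^ 2 / (2 * U.1), U.2.1) + d.pt eos :=
  rawRHS_eq_pieces Z d (U.1, U.2.2 - ‖U.2.1‖ ^ 2 / (2 * U.1), U.2.1)

/-- (C6d) The raw right-hand side at the shell state, with the selected cut-off, written with the integrands of
the shell's hypotheses (H1)–(H3): `rawRHS = -(H2-integrand) + (H1-integrand) - (H3-integrand) + ∂ₜp̃`. [folklore] -/
theorem rawRHS_shell (a b : ℝ) (d : StrongPointData) (U : ℝ × EuclideanSpace ℝ (Fin 3) × ℝ) :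
    rawRHS (monatomicExcess χe f)
        (if 0 < 2 / 3 * (U.2.2 / U.1 - ‖U.2.1‖ ^ 2 / (2 * U.1 ^ 2)) then clamp a b else fun _ => a) d U.1
        (U.2.2 - ‖U.2.1‖ ^ 2 / (2 * U.1)) U.2.1 =
      -(⟪d.Ut, U.2.1⟫_ℝ + ∑ i, ∑ j, d.gU i j * (U.2.1 i * U.2.1 j / U.1 +
          if i = j then U.1 * (2 / 3 * (U.2.2 / U.1 - ‖U.2.1‖ ^ 2 / (2 * U.1 ^ 2))) * χe U.1 else 0)) +
        (U.1 * d.φ₁t (monatomicExcess χe f) + ∑ j, U.2.1 j * d.gφ₁ (monatomicExcess χe f) j) -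
        (U.1 * (if 0 < 2 / 3 * (U.2.2 / U.1 - ‖U.2.1‖ ^ 2 / (2 * U.1 ^ 2)) then
              max a (min (3 / 2 * Real.log (2 / 3 * (U.2.2 / U.1 - ‖U.2.1‖ ^ 2 / (2 * U.1 ^ 2))) -
                Real.log U.1 - f U.1) b) else a) * d.Θt +
          (if 0 < 2 / 3 * (U.2.2 / U.1 - ‖U.2.1‖ ^ 2 / (2 * U.1 ^ 2)) then
              max a (min (3 / 2 * Real.log (2 / 3 * (U.2.2 / U.1 - ‖U.2.1‖ ^ 2 / (2 * U.1 ^ 2))) -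
                Real.log U.1 - f U.1) b) else a) * ⟪U.2.1, d.gΘ⟫_ℝ) +
        d.pt (monatomicExcess χe f) := by
  rw [rawRHS_shell_pieces, momI_shell, contI_shell, ← cutoff_shell χe f a b U, entI_shell]

end Algebra

/-! ## Affine bounds on admissible shell states (`ϱ ≥ 0`, `E ≥ 0`, `|m|² ≤ 2ϱE`) -/

section Bounds

/-- `∑ᵢ |mᵢ| ≤ 3 |m|`. [folklore] -/
theorem sum_abs_apply_le (m : EuclideanSpace ℝ (Fin 3)) : ∑ i, |m i| ≤ 3 * ‖m‖ := by
  calc ∑ i, |m i| ≤ ∑ _i : Fin 3, ‖m‖ :=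
        Finset.sum_le_sum fun i _ => Real.norm_eq_abs (m i) ▸ PiLp.norm_apply_le m i
    _ = 3 * ‖m‖ := by simp

/-- On the vacuum an admissible shell state carries no momentum. [folklore] -/
theorem mom_shell_eq_zero (U : ℝ × EuclideanSpace ℝ (Fin 3) × ℝ) (h0 : U.1 = 0)
    (hm : ‖U.2.1‖ ^ 2 ≤ 2 * U.1 * U.2.2) : U.2.1 = 0 := by
  rw [h0, mul_zero, zero_mul] at hm
  have : ‖U.2.1‖ = 0 := by nlinarith [norm_nonneg U.2.1]
  exact norm_eq_zero.1 this

/-- (C7a) `|m| ≤ ϱ + E` on admissible states (AM–GM from `|m| ≤ √(2ϱE)`). [folklore] -/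
theorem norm_mom_shell_le (U : ℝ × EuclideanSpace ℝ (Fin 3) × ℝ) (hρ : 0 ≤ U.1) (hE : 0 ≤ U.2.2)
    (hm : ‖U.2.1‖ ^ 2 ≤ 2 * U.1 * U.2.2) : ‖U.2.1‖ ≤ U.1 + U.2.2 := by
  have h : ‖U.2.1‖ ^ 2 ≤ (U.1 + U.2.2) ^ 2 := by nlinarith [sq_nonneg (U.1 - U.2.2)]
  exact (sq_le_sq₀ (norm_nonneg _) (by positivity)).1 h

/-- (C7b) The internal energy of an admissible shell state is non-negative (on the vacuum it is `E`). [folklore] -/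
theorem ien_shell_nonneg (U : ℝ × EuclideanSpace ℝ (Fin 3) × ℝ) (hρ : 0 ≤ U.1) (hE : 0 ≤ U.2.2)
    (hm : ‖U.2.1‖ ^ 2 ≤ 2 * U.1 * U.2.2) : 0 ≤ U.2.2 - ‖U.2.1‖ ^ 2 / (2 * U.1) := by
  rcases hρ.eq_or_lt with h | h
  · rw [← h, mul_zero, div_zero, sub_zero]; exact hE
  · rw [sub_nonneg, div_le_iff₀ (by positivity)]; linarith

/-- `|m|²/(2ϱ) ≤ E` on admissible states. [folklore] -/
theorem kinetic_shell_le (U : ℝ × EuclideanSpace ℝ (Fin 3) × ℝ) (hρ : 0 ≤ U.1) (hE : 0 ≤ U.2.2)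
    (hm : ‖U.2.1‖ ^ 2 ≤ 2 * U.1 * U.2.2) : ‖U.2.1‖ ^ 2 / (2 * U.1) ≤ U.2.2 := by
  have := ien_shell_nonneg U hρ hE hm; linarith

/-- (C7c) The internal energy is at most the total energy (`ϱ ≥ 0`). [folklore] -/
theorem ien_shell_le (U : ℝ × EuclideanSpace ℝ (Fin 3) × ℝ) (hρ : 0 ≤ U.1) :
    U.2.2 - ‖U.2.1‖ ^ 2 / (2 * U.1) ≤ U.2.2 :=
  sub_le_self _ (by positivity)

/-- (C7d) `θo U ≥ 0` on admissible states (it vanishes on the vacuum). [folklore] -/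
theorem temp_shell_nonneg (U : ℝ × EuclideanSpace ℝ (Fin 3) × ℝ) (hρ : 0 ≤ U.1) (hE : 0 ≤ U.2.2)
    (hm : ‖U.2.1‖ ^ 2 ≤ 2 * U.1 * U.2.2) :
    0 ≤ 2 / 3 * (U.2.2 / U.1 - ‖U.2.1‖ ^ 2 / (2 * U.1 ^ 2)) := by
  have h0 := ien_shell_nonneg U hρ hE hm
  rw [← stateTemp_shell (fun _ => 0) (fun _ => 0) U]
  simp only [stateTemp, monatomicExcess]
  positivity

/-- `θo U ≤ 2E/(3ϱ)`-type bound in the product form `ϱ · θo U ≤ 2E/3` (all admissible `U`). [folklore] -/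
theorem dens_mul_temp_shell_le (U : ℝ × EuclideanSpace ℝ (Fin 3) × ℝ) (hρ : 0 ≤ U.1) (hE : 0 ≤ U.2.2) :
    U.1 * (2 / 3 * (U.2.2 / U.1 - ‖U.2.1‖ ^ 2 / (2 * U.1 ^ 2))) ≤ 2 / 3 * U.2.2 := by
  rcases hρ.eq_or_lt with h | h
  · rw [← h]; simp; exact hE
  · have e : U.1 * (2 / 3 * (U.2.2 / U.1 - ‖U.2.1‖ ^ 2 / (2 * U.1 ^ 2))) =
        2 / 3 * (U.2.2 - ‖U.2.1‖ ^ 2 / (2 * U.1)) := by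
      field_simp
    rw [e]
    have := ien_shell_le U hρ
    linarith

/-- (C7e) The pressure of an admissible shell state: `|p(w U)| ≤ (2B/3) E` when `|χe| ≤ B` on `(0,∞)`. [folklore] -/
theorem abs_pressure_shell_le {χe : ℝ → ℝ} (f : ℝ → ℝ) {B : ℝ} (hB : ∀ a, 0 < a → |χe a| ≤ B)
    (U : ℝ × EuclideanSpace ℝ (Fin 3) × ℝ) (hρ : 0 ≤ U.1) (hE : 0 ≤ U.2.2)
    (hm : ‖U.2.1‖ ^ 2 ≤ 2 * U.1 * U.2.2) :
    |(monatomicExcess χe f).p U.1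
        (stateTemp (monatomicExcess χe f) U.1 (U.2.2 - ‖U.2.1‖ ^ 2 / (2 * U.1)))| ≤ 2 / 3 * B * U.2.2 := by
  have hB0 : 0 ≤ B := (abs_nonneg _).trans (hB 1 one_pos)
  rw [pressure_shell]
  rcases hρ.eq_or_lt with h | h
  · rw [← h]; simp; positivity
  · have h1 := dens_mul_temp_shell_le U hρ hE
    have h2 : 0 ≤ U.1 * (2 / 3 * (U.2.2 / U.1 - ‖U.2.1‖ ^ 2 / (2 * U.1 ^ 2))) :=
      mul_nonneg hρ (temp_shell_nonneg U hρ hE hm)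
    rw [abs_mul, abs_of_nonneg h2]
    calc _ ≤ 2 / 3 * U.2.2 * B := mul_le_mul h1 (hB _ h) (abs_nonneg _) (by positivity)
      _ = 2 / 3 * B * U.2.2 := by ring

variable {d : StrongPointData} {M : ℝ}

/-- `|∑ᵢ mᵢ cᵢ| ≤ 3M(ϱ + E)` for coefficients `|cᵢ| ≤ M` and an admissible state. [folklore] -/
theorem abs_sum_mom_mul_le {c : Fin 3 → ℝ} (hc : ∀ i, |c i| ≤ M) (U : ℝ × EuclideanSpace ℝ (Fin 3) × ℝ)
    (hρ : 0 ≤ U.1) (hE : 0 ≤ U.2.2) (hm : ‖U.2.1‖ ^ 2 ≤ 2 * U.1 * U.2.2) :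
    |∑ i, U.2.1 i * c i| ≤ 3 * M * (U.1 + U.2.2) := by
  have hM0 : 0 ≤ M := (abs_nonneg _).trans (hc 0)
  have hsum : ∑ i, |U.2.1 i| ≤ 3 * (U.1 + U.2.2) :=
    (sum_abs_apply_le U.2.1).trans (by linarith [norm_mom_shell_le U hρ hE hm])
  have e : ∑ i, U.2.1 i * c i = ∑ i, c i * U.2.1 i := Finset.sum_congr rfl fun i _ => mul_comm _ _
  rw [e]
  calc |∑ i, c i * U.2.1 i| ≤ M * ∑ i, |U.2.1 i| := abs_sum_mul_le univ fun i _ => hc i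
    _ ≤ M * (3 * (U.1 + U.2.2)) := mul_le_mul_of_nonneg_left hsum hM0
    _ = 3 * M * (U.1 + U.2.2) := by ring

/-- `|∑ᵢⱼ mᵢmⱼ/ϱ ∂ⱼŨᵢ| ≤ 6 M E` for an admissible state and `|∂ⱼŨᵢ| ≤ M`. [folklore] -/
theorem abs_sum_sum_mom_le (hd : d.Bounded M) (U : ℝ × EuclideanSpace ℝ (Fin 3) × ℝ)
    (hρ : 0 ≤ U.1) (hE : 0 ≤ U.2.2) (hm : ‖U.2.1‖ ^ 2 ≤ 2 * U.1 * U.2.2) :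
    |∑ i, ∑ j, U.2.1 i * U.2.1 j / U.1 * d.gU i j| ≤ 6 * M * U.2.2 := by
  have hM0 : 0 ≤ M := (abs_nonneg _).trans hd.1
  rcases hρ.eq_or_lt with h | h
  · rw [← h]; simp; positivity
  · have hss := sum_sum_abs_mom_mul_div_le (w := (U.1, (1 : ℝ), U.2.1)) ⟨h, one_pos⟩
    simp only [mom_mk, dens_mk, kineticEnergy] at hss
    have hkin := kinetic_shell_le U hρ hE hm
    calc |∑ i, ∑ j, U.2.1 i * U.2.1 j / U.1 * d.gU i j|
        ≤ ∑ i, ∑ j, |U.2.1 i * U.2.1 j / U.1| * M := (abs_sum_le_sum_abs _ _).trans (sum_le_sum fun i _ =>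
          (abs_sum_le_sum_abs _ _).trans (sum_le_sum fun j _ => by
            rw [abs_mul]
            exact mul_le_mul_of_nonneg_left (hd.2.2.2.2.2.2 i j) (abs_nonneg _)))
      _ = (∑ i, ∑ j, |U.2.1 i * U.2.1 j / U.1|) * M := by rw [sum_mul]; simp [sum_mul]
      _ ≤ 6 * (‖U.2.1‖ ^ 2 / (2 * U.1)) * M := mul_le_mul_of_nonneg_right hss hM0
      _ ≤ 6 * U.2.2 * M := by nlinarith
      _ = 6 * M * U.2.2 := by ring

/-- (C7f) **Affine bound of the relative energy** on admissible shell states: with data bounded by `M` and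
`|Z| ≤ Zb`, `|ℰ_Z(w U)| ≤ E + 3M(ϱ + E) + ϱ(|½|Ũ|² - μ̃| + |Θ̃| Zb) + |p̃|`, for every `eos`. [folklore] -/
theorem abs_relEnergyZ_shell_le (eos : EulerEOS) {Z : ℝ → ℝ} {Zb : ℝ} (hd : d.Bounded M)
    (hZ : ∀ s, |Z s| ≤ Zb) (U : ℝ × EuclideanSpace ℝ (Fin 3) × ℝ) (hρ : 0 ≤ U.1) (hE : 0 ≤ U.2.2)
    (hm : ‖U.2.1‖ ^ 2 ≤ 2 * U.1 * U.2.2) :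
    |d.relEnergyZ eos Z (U.1, U.2.2 - ‖U.2.1‖ ^ 2 / (2 * U.1), U.2.1)| ≤
      U.2.2 + (U.1 + U.2.2) * (3 * M) +
        U.1 * (|‖d.U‖ ^ 2 / 2 - eos.chemPotential d.r d.Θ| + |d.Θ| * Zb) + |eos.p d.r d.Θ| := by
  rw [relEnergyZ_shell]
  set ζ := Z (eos.s U.1 (stateTemp eos U.1 (U.2.2 - ‖U.2.1‖ ^ 2 / (2 * U.1)))) with hζ
  have h1 := abs_le.1 (abs_sum_mom_mul_le hd.2.2.1 U hρ hE hm)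
  have h2 : |U.1 * (‖d.U‖ ^ 2 / 2 - eos.chemPotential d.r d.Θ)| =
      U.1 * |‖d.U‖ ^ 2 / 2 - eos.chemPotential d.r d.Θ| := by
    rw [abs_mul, abs_of_nonneg hρ]
  have h2' := abs_le.1 h2.le
  have h3 : |d.Θ * (U.1 * ζ)| ≤ U.1 * (|d.Θ| * Zb) := by
    rw [abs_mul, abs_mul, abs_of_nonneg hρ]
    calc |d.Θ| * (U.1 * |ζ|) ≤ |d.Θ| * (U.1 * Zb) :=
          mul_le_mul_of_nonneg_left (mul_le_mul_of_nonneg_left (hZ _) hρ) (abs_nonneg _)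
      _ = U.1 * (|d.Θ| * Zb) := by ring
  have h3' := abs_le.1 h3
  have h4 := abs_le.1 (le_refl |eos.p d.r d.Θ|)
  have e : U.1 * (|‖d.U‖ ^ 2 / 2 - eos.chemPotential d.r d.Θ| + |d.Θ| * Zb) =
      U.1 * |‖d.U‖ ^ 2 / 2 - eos.chemPotential d.r d.Θ| + U.1 * (|d.Θ| * Zb) := by ring
  rw [abs_le, e]
  constructor <;> linarith

/-- (C8) **Affine bound of the raw right-hand side** on admissible shell states, for the monatomic class with
`|χe| ≤ B` on `(0,∞)`, data bounded by `M`, `|Z| ≤ Zb`, `|∂ₜφ₁|, |∂ⱼφ₁|, |∂ₜp̃| ≤ N`: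
`|rawRHS| ≤ N + ((9 + 2B + 4Zb) M + 4N)(ϱ + E)`. [folklore] -/
theorem abs_rawRHS_shell_le {χe f : ℝ → ℝ} {B : ℝ} (hB : ∀ a, 0 < a → |χe a| ≤ B) {Z : ℝ → ℝ}
    {Zb N : ℝ} (hd : d.Bounded M) (hZ : ∀ s, |Z s| ≤ Zb) (hN : |d.φ₁t (monatomicExcess χe f)| ≤ N)
    (hN' : ∀ j, |d.gφ₁ (monatomicExcess χe f) j| ≤ N) (hpt : |d.pt (monatomicExcess χe f)| ≤ N)
    (U : ℝ × EuclideanSpace ℝ (Fin 3) × ℝ) (hρ : 0 ≤ U.1) (hE : 0 ≤ U.2.2)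
    (hm : ‖U.2.1‖ ^ 2 ≤ 2 * U.1 * U.2.2) :
    |rawRHS (monatomicExcess χe f) Z d U.1 (U.2.2 - ‖U.2.1‖ ^ 2 / (2 * U.1)) U.2.1| ≤
      N + ((9 + 2 * B + 4 * Zb) * M + 4 * N) * (U.1 + U.2.2) := by
  have hM0 : 0 ≤ M := (abs_nonneg _).trans hd.1
  have hN0 : 0 ≤ N := (abs_nonneg _).trans hpt
  have hB0 : 0 ≤ B := (abs_nonneg _).trans (hB 1 one_pos)
  have hZb0 : 0 ≤ Zb := (abs_nonneg _).trans (hZ 0)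
  set θ := stateTemp (monatomicExcess χe f) U.1 (U.2.2 - ‖U.2.1‖ ^ 2 / (2 * U.1)) with hθ
  set ζ := Z ((monatomicExcess χe f).s U.1 θ) with hζ
  have hζb : |ζ| ≤ Zb := hZ _
  -- the eight pieces
  have h1 := abs_le.1 (abs_sum_mom_mul_le hd.2.2.2.1 U hρ hE hm)
  have h2 := abs_le.1 (abs_sum_sum_mom_le hd U hρ hE hm)
  have h3 : |(monatomicExcess χe f).p U.1 θ * d.divU| ≤ 2 * B * M * U.2.2 := by
    rw [abs_mul]
    calc _ ≤ 2 / 3 * B * U.2.2 * (3 * M) :=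
          mul_le_mul (abs_pressure_shell_le f hB U hρ hE hm) hd.abs_divU_le (abs_nonneg _) (by positivity)
      _ = 2 * B * M * U.2.2 := by ring
  have h3' := abs_le.1 h3
  have h4 : |U.1 * d.φ₁t (monatomicExcess χe f)| ≤ N * U.1 := by
    rw [abs_mul, abs_of_nonneg hρ, mul_comm]
    exact mul_le_mul_of_nonneg_right hN hρ
  have h4' := abs_le.1 h4
  have h5 := abs_le.1 (abs_sum_mom_mul_le hN' U hρ hE hm)
  have h6 : |U.1 * ζ * d.Θt| ≤ Zb * M * U.1 := by
    rw [abs_mul, abs_mul, abs_of_nonneg hρ]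
    calc U.1 * |ζ| * |d.Θt| ≤ U.1 * Zb * M :=
          mul_le_mul (mul_le_mul_of_nonneg_left hζb hρ) hd.2.1 (abs_nonneg _) (by positivity)
      _ = Zb * M * U.1 := by ring
  have h6' := abs_le.1 h6
  have h7 : |∑ i, ζ * U.2.1 i * d.gΘ i| ≤ 3 * (Zb * M) * (U.1 + U.2.2) := by
    have e : ∑ i, ζ * U.2.1 i * d.gΘ i = ∑ i, U.2.1 i * (ζ * d.gΘ i) :=
      Finset.sum_congr rfl fun i _ => by ring
    rw [e]
    refine abs_sum_mom_mul_le (fun i => ?_) U hρ hE hm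
    rw [abs_mul]
    exact mul_le_mul hζb (hd.2.2.2.2.2.1 i) (abs_nonneg _) hZb0
  have h7' := abs_le.1 h7
  have h8 := abs_le.1 hpt
  have hx1 : 2 * B * M * U.2.2 ≤ 2 * B * M * (U.1 + U.2.2) :=
    mul_le_mul_of_nonneg_left (by linarith) (by positivity)
  have hx2 : 6 * M * U.2.2 ≤ 6 * M * (U.1 + U.2.2) := mul_le_mul_of_nonneg_left (by linarith) (by positivity)
  have hx3 : N * U.1 ≤ N * (U.1 + U.2.2) := mul_le_mul_of_nonneg_left (by linarith) hN0
  have hx4 : Zb * M * U.1 ≤ Zb * M * (U.1 + U.2.2) := mul_le_mul_of_nonneg_left (by linarith) (by positivity)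
  have e : N + ((9 + 2 * B + 4 * Zb) * M + 4 * N) * (U.1 + U.2.2) =
      N + 3 * M * (U.1 + U.2.2) + 6 * M * (U.1 + U.2.2) + 2 * B * M * (U.1 + U.2.2) +
        N * (U.1 + U.2.2) + 3 * N * (U.1 + U.2.2) + Zb * M * (U.1 + U.2.2) +
        3 * (Zb * M) * (U.1 + U.2.2) := by ring
  unfold rawRHS
  rw [abs_le, e]
  constructor <;> linarith

end Bounds

/-- REGISTERED SUB-GOAL `stub_bf18ShellSlice` of the line `Sketch` (BF18 shell, the slice identification (C1)):
the temperature of the shell state `(ϱ, E - |m|²/(2ϱ), m)` for the monatomic excess class is the shell's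
`θo U = 2/3 (E/ϱ - |m|²/(2ϱ²))`, for every `U`. [folklore] -/
theorem stub_bf18ShellSlice : ∀ (χe f : ℝ → ℝ) (U : ℝ × EuclideanSpace ℝ (Fin 3) × ℝ), stateTemp (EulerEOS.monatomicExcess χe f) U.1 (U.2.2 - ‖U.2.1‖ ^ 2 / (2 * U.1)) = 2 / 3 * (U.2.2 / U.1 - ‖U.2.1‖ ^ 2 / (2 * U.1 ^ 2)) :=
  fun χe f U => stateTemp_shell χe f U

end Summit.AtomisticToContinuum.HydrodynamicLimit.Theorems.ChaosClosesEulerShellSlice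

end
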